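import Summits.AtomisticToContinuum.BoseEinsteinCondensation.Theorems.FibreConductance.Negative.Profiles

/-!
# Crux `FibreConductance` — one-dimensional integrals and axis functions

* `intervalIntegral_exp_ang_mul_eq_zero`: odd harmonics of an `L/2`-periodic function vanish;
* `intervalIntegral_sin_mul_profiles_ge`: the chamber charge `∫₀ᴸ sin θ · g · f ≥ L/16` (`σ ≤ 1/3`);
* axis functions `axisFun G (y) = G(y₀)` on `ℝ³`: `C¹`, periodicity, `∂_l G(y₀) = δ_{l0} G'(y₀)`,
  `Σ_l |∂_l|² = G'(y₀)²`; cell integrals of functions of the first coordinate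
  (`integral_cell_comp_coord0`, `lintegral_cell_comp_coord0`: `∫_{[0,L)³} F(y₀) = L² ∫₀ᴸ F`).

Crux disprover file for `stmt-AtomisticToContinuum-9480` (route `BECThomsonPrinciple`, crux
`FibreConductance`); part of the chain `Profiles → OneDimAxis → (FibreVocabulary) → SlabState →
TestFunction → NearMinimiserFalse` proving `not_fibreConductanceNearMinimiser`: the exact-minimiser
hypothesis (H1) of the crux cannot be relaxed to `δ`-near-minimality for any `δ > 0`.
All [folklore] (elementary real analysis).
-/

noncomputable section

namespace Summit.AtomisticToContinuum.BoseEinsteinCondensation.Theorems.FibreConductance.Negative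

open MeasureTheory Literature.MathematicalPhysics.QuantumManyBody.BoseGas
open scoped ENNReal NNReal

/-! ### One-dimensional integrals -/

section OneDim

open Real intervalIntegral

variable {L σ : ℝ}

/-- A continuous function that flips sign under the half-period shift integrates to zero over a
period. [folklore] -/
theorem intervalIntegral_eq_zero_of_antiperiodic {F : ℝ → ℂ} (hF : Continuous F)
    (h : ∀ t, F (t + L / 2) = -F t) : ∫ t in (0 : ℝ)..L, F t = 0 := by
  have hi : ∀ a b : ℝ, IntervalIntegrable F volume a b := fun a b => hF.intervalIntegrable a b
  rw [← integral_add_adjacent_intervals (hi 0 (L / 2)) (hi (L / 2) L)]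
  have h2 : ∫ t in (L / 2)..L, F t = -∫ t in (0 : ℝ)..(L / 2), F t := by
    have := integral_comp_add_right (a := 0) (b := L / 2) F (L / 2)
    rw [zero_add, show L / 2 + L / 2 = L by ring] at this
    rw [← this]
    simp_rw [h]
    exact integral_neg
  rw [h2, add_neg_cancel]

/-- `e^{iθ(t + L/2)} = -e^{iθ(t)}`. [folklore] -/
theorem exp_ang_add_half (hL : L ≠ 0) (t : ℝ) :
    Complex.exp (Complex.I * (ang L (t + L / 2) : ℝ)) = -Complex.exp (Complex.I * (ang L t : ℝ)) := by
  have : ang L (t + L / 2) = ang L t + π := by unfold ang; field_simp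
  rw [this, ← Complex.exp_add_pi_mul_I]
  congr 1
  push_cast
  ring

/-- **Odd harmonics of an `L/2`-periodic function vanish**: `∫₀ᴸ e^{2πit/L} G(t) dt = 0` when
`G(t + L/2) = G(t)`. [folklore] -/
theorem intervalIntegral_exp_ang_mul_eq_zero {G : ℝ → ℂ} (hG : Continuous G) (hL : 0 < L)
    (h : ∀ t, G (t + L / 2) = G t) :
    ∫ t in (0 : ℝ)..L, Complex.exp (Complex.I * (ang L t : ℝ)) * G t = 0 := by
  have hc : Continuous (ang L) := (contDiff_ang L).continuous
  refine intervalIntegral_eq_zero_of_antiperiodic (by fun_prop) (fun t => ?_)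
  rw [exp_ang_add_half hL.ne', h, neg_mul]

/-- On the chamber `[L/8, 3L/8]`: `sin θ ≥ 1/2`. [folklore] -/
theorem half_le_sin_ang (hL : 0 < L) {t : ℝ} (ht : t ∈ Set.Icc (L / 8) (3 * L / 8)) :
    1 / 2 ≤ sin (ang L t) := by
  have hθ1 : π / 4 ≤ ang L t := by
    unfold ang; rw [show π / 4 = 2 * π * (L / 8) / L by field_simp; ring]; gcongr; exact ht.1
  have hθ2 : ang L t ≤ 3 * π / 4 := by
    unfold ang; rw [show 3 * π / 4 = 2 * π * (3 * L / 8) / L by field_simp; ring]; gcongr; exact ht.2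
  by_cases hc : ang L t ≤ π / 2
  · calc (1 : ℝ) / 2 = 2 / π * (π / 4) := by field_simp; ring
      _ ≤ 2 / π * ang L t := by gcongr
      _ ≤ sin (ang L t) := mul_le_sin (by linarith [pi_pos]) hc
  · push Not at hc
    rw [← sin_pi_sub]
    calc (1 : ℝ) / 2 = 2 / π * (π / 4) := by field_simp; ring
      _ ≤ 2 / π * (π - ang L t) := by gcongr; linarith
      _ ≤ sin (π - ang L t) := mul_le_sin (by linarith) (by linarith)

/-- The integrand `sin θ · g · f` is bounded below by `-σ/4` everywhere. [folklore] -/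
theorem sin_mul_profiles_ge (hσ0 : 0 ≤ σ) (hσ1 : σ ≤ 1) (L t : ℝ) :
    -(σ / 4) ≤ sin (ang L t) * slabProfile L σ t * testProfile L t := by
  have hg := slabProfile_mem hσ1 L t
  have hf := testProfile_mem L t
  by_cases hs : 0 ≤ sin (ang L t)
  · have : 0 ≤ sin (ang L t) * slabProfile L σ t * testProfile L t :=
      mul_nonneg (mul_nonneg hs (hσ0.trans hg.1)) hf.1
    linarith
  · push Not at hs
    by_cases hs2 : sin (ang L t) ≤ -(1 / 4)
    · rw [testProfile_eq_zero hs2, mul_zero]; linarith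
    · push Not at hs2
      have habs : |sin (ang L t)| ≤ 1 / 2 := by rw [abs_le]; constructor <;> linarith
      rw [slabProfile_eq_of_abs_sin_le habs]
      have h1 : sin (ang L t) * σ ≤ 0 := mul_nonpos_of_nonpos_of_nonneg hs.le hσ0
      have h2 : sin (ang L t) * σ * testProfile L t ≥ sin (ang L t) * σ := by
        have := mul_le_mul_of_nonpos_left hf.2 h1
        linarith [this]
      nlinarith

/-- On the chamber the integrand is `≥ 1/2`. [folklore] -/
theorem sin_mul_profiles_ge_half (hL : 0 < L) {t : ℝ} (ht : t ∈ Set.Icc (L / 8) (3 * L / 8)) :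
    1 / 2 ≤ sin (ang L t) * slabProfile L σ t * testProfile L t := by
  have hs := half_le_sin_ang hL ht
  rw [slabProfile_eq_one hL ht, testProfile_eq_one (by linarith), mul_one, mul_one]
  exact hs

/-- The integrand `sin θ · g · f` is continuous. [folklore] -/
theorem continuous_sin_mul_profiles (L σ : ℝ) :
    Continuous fun t => sin (ang L t) * slabProfile L σ t * testProfile L t := by
  have h1 := (contDiff_ang L).continuous
  have h2 := (contDiff_slabProfile L σ).continuous
  have h3 := (contDiff_testProfile L).continuous
  fun_prop

/-- **The chamber charge is not small**: `∫₀ᴸ sin θ · g · f ≥ L/16` for `σ ≤ 1/3`. [folklore] -/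
theorem intervalIntegral_sin_mul_profiles_ge (hL : 0 < L) (hσ0 : 0 ≤ σ) (hσ : σ ≤ 1 / 3) :
    L / 16 ≤ ∫ t in (0 : ℝ)..L, sin (ang L t) * slabProfile L σ t * testProfile L t := by
  set P : ℝ → ℝ := fun t => sin (ang L t) * slabProfile L σ t * testProfile L t with hP
  have hc : Continuous P := continuous_sin_mul_profiles L σ
  have hi : ∀ a b : ℝ, IntervalIntegrable P volume a b := fun a b => hc.intervalIntegrable a b
  have hσ1 : σ ≤ 1 := hσ.trans (by norm_num)
  have hlow : ∀ a b : ℝ, a ≤ b → (b - a) * (-(σ / 4)) ≤ ∫ t in a..b, P t := by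
    intro a b hab
    have := integral_mono_on hab (intervalIntegrable_const (c := -(σ / 4))) (hi a b)
      (fun t _ => sin_mul_profiles_ge hσ0 hσ1 L t)
    rwa [intervalIntegral.integral_const, smul_eq_mul] at this
  have hmid : (3 * L / 8 - L / 8) * (1 / 2) ≤ ∫ t in (L / 8)..(3 * L / 8), P t := by
    have := integral_mono_on (by linarith) (intervalIntegrable_const (c := 1 / 2)) (hi _ _)
      (fun t ht => sin_mul_profiles_ge_half (σ := σ) hL ht)
    rwa [intervalIntegral.integral_const, smul_eq_mul] at this
  rw [← integral_add_adjacent_intervals (hi 0 (L / 8)) (hi (L / 8) L),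
    ← integral_add_adjacent_intervals (hi (L / 8) (3 * L / 8)) (hi (3 * L / 8) L)]
  have h1 := hlow 0 (L / 8) (by linarith)
  have h3 := hlow (3 * L / 8) L (by linarith)
  nlinarith

end OneDim

/-! ### Functions of the first coordinate -/

section Axis

variable {L : ℝ}

/-- The first-coordinate functional `y ↦ y₀` as a continuous linear map. [folklore] -/
def coord0 : Space →L[ℝ] ℝ := PiLp.proj 2 (fun _ : Fin 3 => ℝ) 0

/-- `coord0 y = y₀`. [folklore] -/
@[simp] theorem coord0_apply (y : Space) : coord0 y = y 0 := rfl

/-- Lift of a real profile to a complex one-body function of the first coordinate. [folklore] -/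
def axisFun (G : ℝ → ℝ) (y : Space) : ℂ := ((G (y 0) : ℝ) : ℂ)

/-- Axis functions of `C¹` profiles are `C¹`. [folklore] -/
theorem contDiff_axisFun {G : ℝ → ℝ} (hG : ContDiff ℝ 1 G) : ContDiff ℝ 1 (axisFun G) := by
  unfold axisFun
  exact Complex.ofRealCLM.contDiff.comp (hG.comp coord0.contDiff)

/-- Axis functions of continuous profiles are continuous. [folklore] -/
theorem continuous_axisFun {G : ℝ → ℝ} (hG : Continuous G) : Continuous (axisFun G) := by
  unfold axisFun
  exact Complex.continuous_ofReal.comp (hG.comp coord0.continuous)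

/-- **Derivative of an axis function**: `∂_l G(y₀) = δ_{l0} G'(y₀)`. [folklore] -/
theorem hasFDerivAt_axisFun {G : ℝ → ℝ} (hG : Differentiable ℝ G) (y : Space) :
    HasFDerivAt (axisFun G) (Complex.ofRealCLM.comp (deriv G (y 0) • coord0)) y := by
  unfold axisFun
  have h1 : HasFDerivAt (fun y : Space => G (y 0)) (deriv G (y 0) • coord0) y :=
    (hG (y 0)).hasDerivAt.comp_hasFDerivAt y coord0.hasFDerivAt
  exact Complex.ofRealCLM.hasFDerivAt.comp y h1

/-- `∂_l G(y₀) = δ_{l0} G'(y₀)`, coordinate form. [folklore] -/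
theorem fderiv_axisFun_single {G : ℝ → ℝ} (hG : Differentiable ℝ G) (y : Space) (l : Fin 3) :
    fderiv ℝ (axisFun G) y (EuclideanSpace.single l 1) =
      if l = 0 then ((deriv G (y 0) : ℝ) : ℂ) else 0 := by
  rw [(hasFDerivAt_axisFun hG y).fderiv, ContinuousLinearMap.comp_apply, smul_apply, coord0_apply]
  by_cases hl : l = 0
  · subst hl; simp
  · rw [if_neg hl]
    have : (EuclideanSpace.single l (1 : ℝ) : Space) 0 = 0 := by
      rw [EuclideanSpace.single, PiLp.single_apply, if_neg (Ne.symm hl)]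
    rw [this, smul_zero, Complex.ofRealCLM_apply, Complex.ofReal_zero]

/-- `Σ_l ‖∂_l G(y₀)‖² = G'(y₀)²`. [folklore] -/
theorem sum_norm_sq_fderiv_axisFun {G : ℝ → ℝ} (hG : Differentiable ℝ G) (y : Space) :
    ∑ l : Fin 3, ‖fderiv ℝ (axisFun G) y (EuclideanSpace.single l 1)‖ ^ 2 = deriv G (y 0) ^ 2 := by
  simp_rw [fderiv_axisFun_single hG]
  rw [Fin.sum_univ_three]
  simp [Complex.norm_real, sq_abs]

/-- `Σ_l ‖∂_l G(y₀)‖₊² = ofReal (G'(y₀)²)` (`ℝ≥0∞` form). [folklore] -/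
theorem sum_nnnorm_sq_fderiv_axisFun {G : ℝ → ℝ} (hG : Differentiable ℝ G) (y : Space) :
    ∑ l : Fin 3, ((‖fderiv ℝ (axisFun G) y (EuclideanSpace.single l 1)‖₊ : ℝ≥0∞) ^ 2) =
      ENNReal.ofReal (deriv G (y 0) ^ 2) := by
  simp_rw [coe_nnnorm_sq_eq_ofReal]
  rw [← ENNReal.ofReal_sum_of_nonneg (fun l _ => by positivity), sum_norm_sq_fderiv_axisFun hG]

/-- Axis functions of `L`-periodic profiles are `Lℤ³`-periodic. [folklore] -/
theorem axisFun_periodic {G : ℝ → ℝ} (hG : ∀ t, G (t + L) = G t) (y : Space) (k : Fin 3) :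
    axisFun G (y + EuclideanSpace.single k L) = axisFun G y := by
  unfold axisFun
  rw [PiLp.add_apply, EuclideanSpace.single, PiLp.single_apply]
  by_cases hk : (0 : Fin 3) = k
  · rw [if_pos hk, hG]
  · rw [if_neg hk, add_zero]

/-- **Cell integral of a function of the first coordinate**:
`∫_{[0,L)³} F(y₀) dy = L² ∫₀ᴸ F`. [folklore] -/
theorem integral_cell_comp_coord0 (hL : 0 ≤ L) (F : ℝ → ℂ) :
    ∫ y in cell L, F (y 0) = ((L : ℂ) ^ 2) * ∫ t in Set.Ico 0 L, F t := by
  have hpre : (WithLp.toLp 2 : (Fin 3 → ℝ) → Space) ⁻¹' cell L = Set.univ.pi fun _ => Set.Ico 0 L := by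
    ext y; simp [cell]
  have hmp := PiLp.volume_preserving_toLp (Fin 3)
  have hme : MeasurableEmbedding (WithLp.toLp 2 : (Fin 3 → ℝ) → Space) :=
    (MeasurableEquiv.toLp 2 (Fin 3 → ℝ)).measurableEmbedding
  rw [← hmp.setIntegral_preimage_emb hme, hpre]
  set g : Fin 3 → ℝ → ℂ := fun c t => if c = 0 then F t else 1 with hg
  have hprod : ∀ y : Fin 3 → ℝ, F ((WithLp.toLp 2 y : Space) 0) = ∏ c, g c (y c) := by
    intro y
    rw [Fin.prod_univ_three, hg]
    simp
  simp_rw [hprod]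
  rw [volume_pi, Measure.restrict_pi_pi, integral_fintype_prod_eq_prod, Fin.prod_univ_three]
  have h0 : g 0 = F := by funext t; simp [hg]
  have h1 : g 1 = fun _ => 1 := by funext t; simp [hg]
  have h2 : g 2 = fun _ => 1 := by funext t; simp [hg]
  rw [h0, h1, h2, setIntegral_const, Measure.real, Real.volume_Ico, sub_zero, ENNReal.toReal_ofReal hL,
    Complex.real_smul, mul_one]
  ring

/-- `ℝ≥0∞` version: `∫⁻_{[0,L)³} F(y₀) dy = L² ∫⁻₀ᴸ F`. [folklore] -/
theorem lintegral_cell_comp_coord0 {F : ℝ → ℝ≥0∞} (hF : Measurable F) :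
    ∫⁻ y in cell L, F (y 0) = ENNReal.ofReal L ^ 2 * ∫⁻ t in Set.Ico 0 L, F t := by
  have hpre : (WithLp.toLp 2 : (Fin 3 → ℝ) → Space) ⁻¹' cell L = Set.univ.pi fun _ => Set.Ico 0 L := by
    ext y; simp [cell]
  have hmp := PiLp.volume_preserving_toLp (Fin 3)
  have hme : MeasurableEmbedding (WithLp.toLp 2 : (Fin 3 → ℝ) → Space) :=
    (MeasurableEquiv.toLp 2 (Fin 3 → ℝ)).measurableEmbedding
  rw [← hmp.setLIntegral_comp_preimage_emb hme, hpre]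
  set g : Fin 3 → ℝ → ℝ≥0∞ := fun c t => if c = 0 then F t else 1 with hg
  have hprod : ∀ y : Fin 3 → ℝ, F ((WithLp.toLp 2 y : Space) 0) = ∏ c, g c (y c) := by
    intro y
    rw [Fin.prod_univ_three, hg]
    simp
  simp_rw [hprod]
  have hgm : ∀ c, Measurable (g c) := fun c => by
    show Measurable (fun t => if c = 0 then F t else 1)
    split_ifs
    exacts [hF, measurable_const]
  rw [volume_pi, Measure.restrict_pi_pi,
    Literature.Probability.Distributions.lintegral_fin_nat_prod_eq_prod _ g hgm, Fin.prod_univ_three]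
  have h0 : g 0 = F := by funext t; simp [hg]
  have h1 : g 1 = fun _ => 1 := by funext t; simp [hg]
  have h2 : g 2 = fun _ => 1 := by funext t; simp [hg]
  rw [h0, h1, h2, setLIntegral_const, Real.volume_Ico, sub_zero]
  ring

end Axis

end Summit.AtomisticToContinuum.BoseEinsteinCondensation.Theorems.FibreConductance.Negative

end
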